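import Summits.MatrixMultiplication.MatrixMultiplication.Theorems.OutsiderSandwichSubrankSix
import Summits.MatrixMultiplication.MatrixMultiplication.Theorems.OutsiderSandwichPackFloors

/-!
# OutsiderSandwich — `Q(cw₂^{⊠2}) = 6` (the `N = 2` diagonal cell of the packing census, decided)
(decomp-mm lens 4 «minimal-counterexample / extremal reduction», gen 39, kernel K39-d; corollary file)

CONE NOTE.  The ceiling `Q(cw₂^{⊠2}) ≤ 6` (`OutsiderSandwichSubrankSix.subrank_cwPow_two_le_six`,
K39-c) is THESES-FREE.  The floor `⟨6⟩ ≤ cw₂^{⊠2}` is the zeroing-out certificate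
`OutsiderSandwichPackFloors.cwPow_two_restrictsTo_unitSix_complex` (a `decide`d combinatorial
degeneration), whose file sits transitively in the import cone of `Theses.OutsiderSandwich` (via the
packing-census Parts I–II); this two-line corollary therefore does too, and is kept separate so that
the Theses-free kernel K39-a/b/c stays Theses-free.

Census update (diagonal cells `m = 1`, over `ℂ`; floor ‖ ceiling): `N = 1`: `2 ‖ 2`
(`OutsiderSandwichPackingSlack.subrank_cwPow_one`); `N = 2`: `6 ‖ 6` (this file; was `6 ‖ 7`);
`N = 3`: `14 ‖ 23`; `N = 4`: `36 ‖ 73` (`OutsiderSandwichPackFloors.subrank_floors` ‖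
`OutsiderSandwichPackingSlack.subrank_window`).

References: [cite: ChristandlVranaZuiddam2023, §1.1]; [cite: CoppersmithWinograd1990, §6].
-/

set_option linter.dupNamespace false

noncomputable section

namespace Summit.MatrixMultiplication.MatrixMultiplication.Theorems.OutsiderSandwichCwSquareSubrank

open Literature.Computability.AlgebraicComplexity

/-- **`Q(cw₂^{⊠2}) = 6`**: the subrank of the Kronecker square of the Coppersmith–Winograd tensor
`T_{cw,2}` over `ℂ` is exactly `6` (`< 7`, the pencil-law ceiling; `> 4 = Q(cw₂)²`, the product
floor — subrank is strictly super-multiplicative here). [cite: ChristandlVranaZuiddam2023, §1.1] -/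
theorem subrank_cwPow_two : subrank ℂ (kroneckerPow (cwTensor ℂ 2) 2) = 6 :=
  le_antisymm OutsiderSandwichSubrankSix.subrank_cwPow_two_le_six
    (Literature.Barriers.MatrixMultiplication.le_subrank_of_restrictsTo
      OutsiderSandwichPackFloors.cwPow_two_restrictsTo_unitSix_complex)

/-- The `N = 2` diagonal cell in window form: `⟨B⟩ ≤ cw₂^{⊠2} ↔ B ≤ 6`.
[cite: ChristandlVranaZuiddam2023, §1.1] -/
theorem unitTensor_le_cwPow_two_iff (B : ℕ) :
    TensorRestrictsTo (kroneckerPow (cwTensor ℂ 2) 2) (unitTensor ℂ B) ↔ B ≤ 6 := by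
  rw [Literature.Barriers.MatrixMultiplication.restrictsTo_unitTensor_iff_le_subrank, subrank_cwPow_two]

end Summit.MatrixMultiplication.MatrixMultiplication.Theorems.OutsiderSandwichCwSquareSubrank
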